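import Literature.MathematicalPhysics.QuantumFieldTheory.Balaban1983to89.Beta.RemainderOriginTowerClosed
import Literature.MathematicalPhysics.QuantumFieldTheory.Balaban1983to89.B9Eq326OperatorTowerRealityUnitary
import Literature.MathematicalPhysics.QuantumFieldTheory.Balaban1983to89.B9Thm311LaplaceAkPositiveDiagonal
import Literature.MathematicalPhysics.QuantumFieldTheory.Balaban1983to89.B9Thm311SitePrimeFormCoerciveTowerCanonical
import Literature.MathematicalPhysics.QuantumFieldTheory.Balaban1983to89.B9Eq315QTowerRegularityDisplay
import Literature.MathematicalPhysics.QuantumFieldTheory.Balaban1983to89.B9Eq342GreenPrimeSupBound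

/-!
# T. Bałaban, *Propagators for lattice gauge theories in a background field*, Commun. Math. Phys. **99** (1985) 389–434 [Balaban1985BackgroundPropagators]
# (3.133) p. 422 for `H₁ = G₁Q*(QG₁Q*)⁻¹` ((3.126) p. 420, p. 423), Thm 3.3 (3.42) pp. 397–399, Thm 3.11 p. 416, (3.35)–(3.37) p. 396, with
# [Balaban1985Averaging] Prop. 2 (52)–(54) p. 26 and [Balaban1985Variational] (129) p. 297, (190) p. 308: **[5] (3.133), FIRST ENTRY, FOR `H₁,k(U)` ON
# NE9's TOWER IN THE (190) SUP CURRENCY — ON PRINT's SMALL-FIELD CLASS (3.35)–(3.36): unitary values, bond variables `‖U(b) − 1‖ ≤ αη`, plaquette variables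
# `‖U(∂p) − 1‖ ≤ αη²`, bond gradients `‖U(x,μ) − U(x − e_μ,μ)‖ ≤ αη²` — THE MODEL LETTERS OF «Y5c» (regularity display of `Q_k(U)` with its
# onto-threshold, level profile, `U1`-memberships, unitarity, contractive transporters, the positivity of `Δ_{a,k}(U)` and `Δ′_{a′,k}(U)`) ALL DERIVED**

CITATION HEADER (lean-in-tree rule 2026-08-18).  Sources: [Balaban1985Variational] (B11 = [15]; held `paper:balaban1985-cmp102-variational-background`, journal
page = PDF page + 276): (129) p. 297, (180) p. 306, (182) p. 307, (190) p. 308; [Balaban1985BackgroundPropagators] (B9 = [5];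
`paper:balaban1985-cmp99-background-propagators`, journal page = PDF page + 388): (3.15) p. 393, (3.26) p. 395, (3.35)–(3.37) p. 396 (*«|U(∂p) − 1| < α₀η² …
U with values in the unitary group»*, the smallness of `U` and of the averages `Ū^j`), Thm 3.1 (3.42) p. 397, Thm 3.3 p. 399, Thm 3.11 p. 416 (*«Under the
assumptions of the Theorems 3.1–3.10 (i.e. for M sufficiently large and α₀ sufficiently small) the operators Δ′_a, G′, (Q′G′²Q′*)⁻¹, Δ_a, G are positive
definite.»*), (3.126) p. 420, (3.132)–(3.133) p. 422, (3.137) p. 423; [Balaban1985Averaging] (B7 = [4]; `paper:balaban1985-cmp98-averaging`, journal page =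
PDF page + 16): Prop. 2 (52)–(54) p. 26, (53) p. 26, p. 25 (before (47)), p. 37 (after (127)), (42)–(43) pp. 23–24, (18) p. 21; [Balaban1984PropagatorsII]
(B6) (2.51)–(2.52) p. 232, (2.54) p. 233, Lemma 2.1 (2.61) p. 234.  [5] pp. 396, 416, 420–423 and [15] pp. 306–308 re-read this generation in the held text
layers; the other loci as printed in the headers of the tree files consumed.

WHY THIS FILE (audit cell `pub-balaban`, BINDER row (D4), OWNER lineage `b2b-balaban-beta-an4`, gen 112; «Y12a»).  «Y5c»
`Beta.RemainderOriginTowerClosed.exists_ineq190_origin_tower` ∕ `exists_hasMaj_H1k_tower` — NODE D at the origin on `Ω_k = T_η` with `∃ (α⋆, B, δ, A′, r₁)`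
first — still display, under the `∀`, the cell's MODEL letters of the NE9 crew's (K64) ∕ (FCLK) blocks: the regularity display `αU` of the level averages
`Ū^j` (`hα0`, `hα1`, the onto-threshold `hαL : 50(d+1)·αU_j·L^d ≤ ½`, `hU1`, `hreg`, the summable regime `Σ_{j<n+1} αU_j ≤ A_Q`), the level profile
`‖Ū^j(b) − 1‖ ≤ ε_j ≤ αϱ^j`, the memberships `U(b), Ū^j(b) ∈ U1`, unitarity as `star U(b) = U(b)⁻¹`, contractive transporters `hRlev`, and the positivity
witnesses `hpos′` (of `Δ′_{a′,k}(U)`, [5] Thm 3.1's site operator) and `hpos` (of `Δ_{a,k}(U)`, Thm 3.3's bond operator WITH the Hessian's curvature part) —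
[5] Thm 3.11.  ON PRINT's CLASS every one of them is a tree theorem: the LEVEL PROFILE by ne9-leaf-03's AREA count
`B7Eq43AveragedSmallnessLevelFree.exists_profile_of_windows_eta` (`r = 1∕L`); the unitarity of the averages by [4] Prop. 2 (`UlevOf_mem` at the `AvgClosed`
subgroup `unitaryUnits`); `hRlev` by `B9Eq342GreenPrimeSupBound.norm_adTransportW_eq`; `hRS` by `B9Eq310HessianHermitian.adTransportW_adjoint`; the
REGULARITY DISPLAY by ne9-leaf-02's `B9Eq315QTowerRegularityDisplay` road — HERE with the junk-depth bound `αU_j ≤ α_T = 32(d+1)(d+4)L²α_P` EXPORTED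
(`exists_reg_profile_le`, the one line memo `FLAT-LETTERS-LOCATED.md` §21 (iv) recorded as missing for a print's-class `hαL`), so that the onto-threshold of
`Q_k(U)` is a SMALLNESS OF THE PLAQUETTE WINDOW (`3200(d+1)²(d+4)L^{d+2}α_P ≤ 1`) and the summable regime is the geometric sum
`Σ_{j<n+1} αU_j ≤ 16(d+1)(d+4)c₂′(d,L)`; the positivity of the BOND operator by the NE9 OWNER's `B9Thm311LaplaceAkPositiveDiagonal.exists_laplaceAk_pos_diagonal_closed`
and of the SITE operator by `B9Thm311SitePrimeFormCoerciveTowerCanonical.exists_strong_site_coercive_tower_diagonal` — both `∃ α₀` BEFORE the height.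
THIS FILE composes them for the `H₁,k` half («Y3g» `Beta.RemainderHasMajGreenPrimeTowerDecayCoshPlaquette`'s bookkeeping, now for the bond side; the END
with `Δ⁽²⁾` is the successor file «Y12b» `Beta.RemainderOriginTowerPlaquette`):
* `exists_reg_profile_le` — [4] Prop. 2's regularity display of the level backgrounds of `Q_k(U)` with the uniform bound `αU_j ≤ α_T` AND the geometric
  profile on the composed depths AND the `U1`-membership of every level (`G`-valued `U`, (52));
* `letters_of_windows` — on print's class with [4] Prop. 2's numeric window `α_P` chosen by the caller: ALL of «Y5c»'s structural binders (bookkeeping, also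
  consumed by «Y12b»);
* **`exists_hasMaj_H1k_tower_plaquette`** — [5] (3.133), first entry, for `H₁,k(U)` in the (190) sup currency, `∃ (α⋆, B, δ, A′, r₁)` first, under the `∀`
  ONLY: the height on print's diagonal, the weights (`c₀(L^{n+1})^d = c₁`, `|η|^d∕c₀ ≤ ρ_w`), the period, a `unitaryUnits`-valued background in the
  THREE-WINDOW class with `0 ≤ α ≤ α⋆`, the geometry and the rates; CONCLUSION `∃ αU hα1 hαL hU1 hreg hpos, HasMaj S^{coarse}_m S^{fine}_m (H₁,k(U)ᵉ↾ℝ) (…·e^{−ρd})`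
  with `H₁,k(U) = B9Eq326OperatorTower.H1k … αU hα1 hU1 hreg … hαL hpos` at the DERIVED display and positivity witness (the operator does not depend on the
  display nor on the witness — a consumer holding its own display reads the same map: «Y12c» `Beta.RemainderTowerDisplayIrrel.H1k_display_irrel`);
Mechanism: «Y5c» `exists_hasMaj_H1k_tower` at `ϱ := 1∕L` and the caller's `A_Q`; the two Thm 3.11 theorems at `r := 1∕L`; `A := min(α⋆_{Y5c}, α₀^{bond}, α₀^{site})`; [4] Prop. 2's
window CHOSEN INSIDE as `α_P = 2α⋆`, `α⋆ = min(min(1∕(6C₀), c₂′∕8), min(1∕(2·3200(d+1)²(d+4)L^{d+2}), A∕(4K+1)))`, `K = 256(d+1)(d+4)`; the common smallness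
`α″ = α + 2Kα⋆ ≤ A`; threshold `min(A∕2, α⋆)`.

HONEST SCOPE.  [folklore] bookkeeping BY NAME over the NE9 cell's theorems and «Y5c»; NO estimate of [5], [15] or [4] is proved here; constants are the cell's
crude ones.  What stays DISPLAYED is print's (3.35)–(3.36) read GLOBALLY on the torus (the fine-bond and bond-gradient windows are NOT derived from the
plaquette window: non-contractible holonomies — print's statement is per cube, Lemma 3.1 ∕ [4] (44)–(47), «the gauge question» as in the cell's `…TwoWindows`
files), the weight normalisation `ρ_w` and the Hilbert-structure letters (`φ`, `τ`).  Nothing identifies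
Bałaban's step-`k` objects with tree terms beyond NE9's tower (NODE O ∕ A FROZEN (0); the multi-level `{Ω_j}` case untouched).  Row (D4) class UNCHANGED
(instance 0∕1; D4 DISCHARGE NO DATE); NOT B12 Thm 2, NOT BetaPertH, NOT continuum, NOT Clay.  HONEST DEPENDENCY (cell line): continuum YM on T⁴ ⇐ BetaPertH ∧
nine spine estimates (0/9 proved); BetaPertH ⇐ (D1) ∧ (D4) ∧ CAP+tail; G-an2-4 gates asym, D1 and NE2/3/4.  NEW file importing «Y5c» `Beta.RemainderOriginTowerClosed`
and five BUILT NE9-cell modules; nothing modified; 0 `def`; standard axioms; no `sorry`.  Net new unproved facts: 0.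
-/

noncomputable section

open scoped BigOperators InnerProductSpace ComplexConjugate

namespace Literature.MathematicalPhysics.QuantumFieldTheory.Balaban1983to89.Beta.RemainderHasMajH1kTowerPlaquette

open B11SectG B11SupSize190
open B4Sect5Torus (TSite tdist tdist_nonneg)
open B4Sect5Proof (latticeConst)
open B5TorusCover (UT)
open B9Thm34Ext (toB6)
open B9Thm37GlueTorus (torusGeom tdist1)
open B9SectCLatticeCarrier (Bond bpos unshift)
open B9Eq311L2Pairing (WL2)
open B9Eq319QprimeTorus (blockCoord)
open B9Eq315QTower (towerP UlevOf)
open B9Eq315QTorus (perCfg perCfg_apply cornerSite)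
open B9Eq316TowerFlatIsOneStep (siteCast towerP_eq_fineP_pow)
open B7Prop1Explicit (U1 Wcx boxVec)
open B7Prop2Explicit (pdev AvgClosed C0 c2' C0_pos c2'_pos unitaryUnits avgClosed_unitaryUnits unitaryUnits_le_U1)
open B7Eq43AveragedSmallnessLevelFree (UlevOf_mem pdev_perCfg_le_of_plaq exists_profile_of_windows_eta)
open B11Eq44COperatorTower (αT αT_le ulev_mem_U1_of_pdev ulev_reg_of_pdev)
open B9Eq315QTowerRegularityDisplay (profile_le_αT)
open B9Eq315QTowerRegularityProfile (ulev_reg_geometric)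
open B9Eq310DeltaPrime (plaqHolU)
open B9Eq310HessianOperator (adTransportW)
open B9Eq310HessianHermitian (adTransportW_adjoint)
open B11Eq103H1Complex (SiteL2K BondL2K KinvLatticeK covDerivL2K)
open B9Eq326OperatorTower (laplaceAk QkW G1k H1k)
open B9Eq324DeltaPrimeATower (laplacePrimeAk)
open B9Eq342GreenPrimeSupBound (norm_adTransportW_eq)
open B9Eq326OperatorTowerRealityUnitary (star_val_eq_inv_of_mem_unitaryUnits forall_star_eq_inv_of_mem)
open B9Thm311LaplaceAkPositiveDiagonal (exists_laplaceAk_pos_diagonal_closed)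
open B9Thm311SitePrimeFormCoerciveTowerCanonical (exists_strong_site_coercive_tower_diagonal)
open Beta.RemainderOriginTowerClosed (exists_hasMaj_H1k_tower)

/-! ## §1 [4] Prop. 2's regularity display of the level backgrounds of `Q_k(U)`, with the uniform bound `α_T` exported -/

section Profile

variable {d : ℕ} (L : ℕ) [NeZero L] (m : Fin d → ℕ) [∀ i, NeZero (m i)] (n : ℕ)
  {𝔸 : Type*} [NormedRing 𝔸] [NormedAlgebra ℂ 𝔸] [CompleteSpace 𝔸] [NormOneClass 𝔸]
  (hL : 2 ≤ L) {G : Subgroup 𝔸ˣ} (hG : AvgClosed d L G)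
  {U : Bond d (towerP L m (n + 1)) → 𝔸ˣ} (hU : ∀ b, U b ∈ G) {α₀ : ℝ} (hα : 0 < α₀)
  (hα3 : C0 d * α₀ ≤ 1 / 3) (hα4 : 4 * α₀ ≤ c2' d L) (h52 : pdev (perCfg (towerP L m (n + 1)) U) < α₀ * (((L : ℝ) ^ (n + 1))⁻¹) ^ 2)

include hL hG hU hα hα3 hα4 h52 in
/-- **THE REGULARITY DISPLAY OF THE LEVEL BACKGROUNDS `Ū^j` OF `Q_k(U)`, WITH THE UNIFORM BOUND EXPORTED** ([4] Prop. 2 (52)–(54) per level and p. 25's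
block-loop reading, on the depth index of `B9Eq315QTower.Qtower`): for a `G`-valued background `U` (`G` averaging-closed, `G ⊆ U1`) on the level-`(n+1)`
torus with `pdev < α₀·(L^{n+1})^{−2}` and print's thresholds on `α₀`, there is ONE display `αU : ℕ → ℝ` with `0 ≤ αU_j ≤ α_T = 32(d+1)(d+4)L²α₀` at EVERY
depth `j` (ne9-leaf-03's `B11Eq44COperatorTower.ulev_reg_of_pdev` at the junk depths `j ≥ n+1`, ne9-leaf-02's `profile_le_αT` on the composed ones),
serving the `hreg` display of `B9Eq326OperatorTower.QkW ∕ laplaceAk ∕ H1k` at every depth, with the geometric profile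
`αU_j ≤ 32(d+1)(d+4)α₀·(L^{−2})^j` for `j < n+1` (the OWNER's `ulev_reg_geometric`), and every level background `U1`-valued (`ulev_mem_U1_of_pdev`).
`B9Eq315QTowerRegularityDisplay.exists_reg_profile_of_pdev` is this statement without the second conjunct (its witness has it; not exported there).
[cite: Balaban1985Averaging, Prop. 2 (52)–(54) p.26, p.25 (before (47)), p.37 (after (127)), (42)–(43) pp.23–24]
[cite: Balaban1985BackgroundPropagators, (3.15) p.393, (3.35)–(3.37) p.396] -/
theorem exists_reg_profile_le :
    ∃ αU : ℕ → ℝ, (∀ j, 0 ≤ αU j) ∧ (∀ j, αU j ≤ αT d L α₀) ∧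
      (∀ (j : ℕ) (x : B7Prop1Explicit.Site d) (κ : Fin d), perCfg (towerP L m (j + 1)) (UlevOf L m (n + 1) U j) x κ ∈ U1 𝔸) ∧
      (∀ (j : ℕ) (y : TSite d (towerP L m j)) (κ : Fin d) (r : Fin d → Fin L),
        ‖((Wcx L (perCfg (towerP L m (j + 1)) (UlevOf L m (n + 1) U j)) (cornerSite L y) κ (boxVec L r) : 𝔸ˣ) : 𝔸) - 1‖ ≤ αU j) ∧
      (∀ j < n + 1, αU j ≤ 32 * ((d : ℝ) + 1) * ((d : ℝ) + 4) * α₀ * (((L : ℝ) ^ 2)⁻¹) ^ j) := by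
  classical
  have hUx : ∀ (x : B7Prop1Explicit.Site d) (κ : Fin d), perCfg (towerP L m (n + 1)) U x κ ∈ G := fun x κ => by
    rw [perCfg_apply]; exact hU _
  refine ⟨fun j => if j < n + 1 then 32 * ((d : ℝ) + 1) * ((d : ℝ) + 4) * α₀ * (((L : ℝ) ^ 2)⁻¹) ^ j else αT d L α₀,
    fun j => ?_, fun j => ?_, fun j x κ => ulev_mem_U1_of_pdev L m (n + 1) U hL hG hUx hα hα3 hα4 h52 j x κ, fun j y κ r => ?_,
    fun j hj => ?_⟩
  · dsimp only
    split_ifs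
    · positivity
    · unfold αT; positivity
  · dsimp only
    split_ifs
    · exact profile_le_αT L hL hα j
    · exact le_rfl
  · dsimp only
    split_ifs with hj
    · exact (ulev_reg_geometric L m (n + 1) U hL hG hUx hα hα3 hα4 h52 hj y κ r).trans (le_of_eq (by ring))
    · exact ulev_reg_of_pdev L m (n + 1) U hL hG hUx hα hα3 hα4 h52 j y κ r
  · dsimp only
    rw [if_pos hj]

end Profile

/-! ## §2 Print's class (3.35)–(3.36) ⟹ every structural binder of «Y5c» (bookkeeping) -/

section Letters

variable {d : ℕ} (L : ℕ) [NeZero L] (m : Fin d → ℕ) [∀ i, NeZero (m i)] (n : ℕ)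
  {𝔸 : Type*} [CStarAlgebra 𝔸] [Nontrivial 𝔸]
  {W : Type} [NormedAddCommGroup W] [InnerProductSpace ℂ W] [FiniteDimensional ℂ W] (φ : W ≃ₗ[ℂ] 𝔸)
  (τ : 𝔸 →ₗ[ℂ] ℂ) (hτ₂ : ∀ X Y : 𝔸, τ (X * Y) = τ (Y * X)) (hφτ : ∀ X Y : 𝔸, ⟪φ.symm X, φ.symm Y⟫_ℂ = τ (star X * Y))
  (hL3 : 3 ≤ L) {U : Bond d (towerP L m (n + 1)) → 𝔸ˣ} (hUu : ∀ b, U b ∈ unitaryUnits 𝔸)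
  {αP : ℝ} (hαP : 0 < αP) (hαP3 : C0 d * αP ≤ 1 / 3) (hαP4 : 4 * αP ≤ c2' d L)
  (hαPL : 3200 * ((d : ℝ) + 1) ^ 2 * ((d : ℝ) + 4) * (L : ℝ) ^ (d + 2) * αP ≤ 1)
  {η α : ℝ} (hηL : η * (L : ℝ) ^ (n + 1) = 1) (hα0 : 0 ≤ α) (hαlt : α < αP)
  (hUη : ∀ b, ‖(U b : 𝔸) - 1‖ ≤ α * η) (hpl : ∀ p : B9SectCLatticeCarrier.Plaq d (towerP L m (n + 1)), ‖(plaqHolU U p : 𝔸) - 1‖ ≤ α * η ^ 2)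

omit [FiniteDimensional ℂ W] in
include hτ₂ hφτ hL3 hUu hαP hαP3 hαP4 hαPL hηL hα0 hαlt hUη hpl in
/-- **PRINT's CLASS ⟹ THE STRUCTURAL BINDERS OF (K64) ∕ (FCLK)** (bookkeeping; [4] Prop. 2's numeric window `α_P` supplied by the caller with
`C₀α_P ≤ ⅓`, `4α_P ≤ c₂′`, `3200(d+1)²(d+4)L^{d+2}α_P ≤ 1`): for a `unitaryUnits`-valued `U` with `‖U(b) − 1‖ ≤ αη`, `‖U(∂p) − 1‖ ≤ αη²`, `0 ≤ α < α_P` on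
the diagonal `ηL^{n+1} = 1` — the regularity display `αU` (`0 ≤ αU_j ≤ 1∕64`, the onto-threshold `50(d+1)αU_jL^d ≤ ½`, `hU1`, `hreg`, the summable regime
`Σ_{j<n+1} αU_j ≤ 16(d+1)(d+4)c₂′`), the level profile `εU` (`‖Ū^j(b) − 1‖ ≤ ε_j`, `ε_j ≤ (α + 256(d+1)(d+4)α_P)(1∕L)^j` for `j < n+1`), `Ū^j(b) ∈ U1`,
`star U(b) = U(b)⁻¹`, `U(b) ∈ U1`, contractive (indeed isometric) transporters at every level, and `hRS`.
[cite: Balaban1985BackgroundPropagators, (3.35)–(3.37) p.396, (3.15) p.393, (3.126) p.420] [cite: Balaban1985Averaging, Prop. 2 (52)–(54) p.26, p.25, (18) p.21] -/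
theorem letters_of_windows :
    ∃ αU εU : ℕ → ℝ,
      (∀ j, 0 ≤ αU j) ∧ (∀ j, αU j ≤ 1 / 64) ∧ (∀ j, 50 * (d + 1) * αU j * (L : ℝ) ^ d ≤ 1 / 2) ∧
      (∀ (j : ℕ) (x : B7Prop1Explicit.Site d) (k : Fin d), perCfg (towerP L m (j + 1)) (UlevOf L m (n + 1) U j) x k ∈ U1 𝔸) ∧
      (∀ (j : ℕ) (y : TSite d (towerP L m j)) (k : Fin d) (ρ' : Fin d → Fin L),
        ‖((Wcx L (perCfg (towerP L m (j + 1)) (UlevOf L m (n + 1) U j)) (cornerSite L y) k (boxVec L ρ') : 𝔸ˣ) : 𝔸) - 1‖ ≤ αU j) ∧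
      (∑ j ∈ Finset.range (n + 1), αU j ≤ 16 * ((d : ℝ) + 1) * ((d : ℝ) + 4) * c2' d L) ∧
      (∀ j, 0 ≤ εU j) ∧ (∀ (j : ℕ) (b : Bond d (towerP L m (j + 1))), ‖(UlevOf L m (n + 1) U j b : 𝔸) - 1‖ ≤ εU j) ∧
      (∀ (j : ℕ) (b : Bond d (towerP L m (j + 1))), UlevOf L m (n + 1) U j b ∈ U1 𝔸) ∧
      (∀ j < n + 1, εU j ≤ (α + 256 * (d + 1) * (d + 4) * αP) * (1 / (L : ℝ)) ^ j) ∧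
      (∀ b, star (U b : 𝔸) = (((U b)⁻¹ : 𝔸ˣ) : 𝔸)) ∧ (∀ b, U b ∈ U1 𝔸) ∧
      (∀ (j : ℕ) (b : Bond d (towerP L m (j + 1))) (w : W), ‖adTransportW φ (UlevOf L m (n + 1) U j) b w‖ ≤ ‖w‖) ∧
      (∀ (b : Bond d (towerP L m (n + 1))) (v u : W), ⟪adTransportW φ U b v, u⟫_ℂ = ⟪v, adTransportW φ (fun b => (U b)⁻¹) b u⟫_ℂ) := by
  have hL2 : 2 ≤ L := le_trans (by norm_num) hL3
  have hL1 : 1 ≤ L := le_trans (by norm_num) hL3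
  have hL1r : (1 : ℝ) ≤ L := by exact_mod_cast hL1
  have hL3r : (3 : ℝ) ≤ L := by exact_mod_cast hL3
  have hL0 : (0 : ℝ) < L := lt_of_lt_of_le one_pos hL1r
  -- print's class: `U⋆ = U⁻¹`, `U ∈ U1`, `hRS`
  have hUst : ∀ b, star (U b : 𝔸) = (((U b)⁻¹ : 𝔸ˣ) : 𝔸) := forall_star_eq_inv_of_mem hUu
  have hUb : ∀ b, U b ∈ U1 𝔸 := fun b => unitaryUnits_le_U1 (hUu b)
  have hRS : ∀ (b : Bond d (towerP L m (n + 1))) (v u : W), ⟪adTransportW φ U b v, u⟫_ℂ = ⟪v, adTransportW φ (fun b => (U b)⁻¹) b u⟫_ℂ :=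
    adTransportW_adjoint φ τ hτ₂ hUst hφτ
  -- [4] Prop. 2's (52) at `α_P` from the plaquette window
  have hη : η = ((L : ℝ) ^ (n + 1))⁻¹ := (inv_eq_of_mul_eq_one_left hηL).symm
  have hpd : pdev (perCfg (towerP L m (n + 1)) U) ≤ α * η ^ 2 := pdev_perCfg_le_of_plaq (U := U) hUb (by positivity) hpl
  have h52 : pdev (perCfg (towerP L m (n + 1)) U) < αP * (((L : ℝ) ^ (n + 1))⁻¹) ^ 2 := by
    rw [← hη]
    have hη2 : 0 < η ^ 2 := by rw [hη]; positivity
    exact hpd.trans_lt (mul_lt_mul_of_pos_right hαlt hη2)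
  have hαP2 : 2 * αP ≤ c2' d L := by linarith
  -- the level averages are unitary, hence in `U1` with isometric transporters
  have hLu : ∀ (j : ℕ) (b : Bond d (towerP L m (j + 1))), UlevOf L m (n + 1) U j b ∈ unitaryUnits 𝔸 := fun j b =>
    UlevOf_mem L m n hL2 (avgClosed_unitaryUnits d L) hUu hαP hαP3 hαP2 h52 j b
  have hLb : ∀ (j : ℕ) (b : Bond d (towerP L m (j + 1))), UlevOf L m (n + 1) U j b ∈ U1 𝔸 := fun j b => unitaryUnits_le_U1 (hLu j b)
  have hRlev : ∀ (j : ℕ) (b : Bond d (towerP L m (j + 1))) (w : W), ‖adTransportW φ (UlevOf L m (n + 1) U j) b w‖ ≤ ‖w‖ := fun j b w =>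
    (norm_adTransportW_eq φ (UlevOf L m (n + 1) U j) τ hτ₂ (fun b => star_val_eq_inv_of_mem_unitaryUnits (hLu j b)) hφτ b w).le
  -- the level profile (3.37) by the AREA count, `r = 1∕L`
  obtain ⟨εU, hεU, hLε, hεg⟩ :=
    exists_profile_of_windows_eta L m n hL2 (avgClosed_unitaryUnits d L) hUu hαP hαP3 hαP2 hηL hα0 hαlt hUη hpl
  -- the regularity display with the uniform bound `α_T`
  obtain ⟨αU, hαU0, hαUT, hU1, hreg, hαg⟩ := exists_reg_profile_le L m n hL2 (avgClosed_unitaryUnits d L) hUu hαP hαP3 hαP4 h52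
  have hT64 : αT d L αP ≤ 1 / 64 := αT_le hL1 hαP4
  have hα1 : ∀ j, αU j ≤ 1 / 64 := fun j => (hαUT j).trans hT64
  have hαL : ∀ j, 50 * (d + 1) * αU j * (L : ℝ) ^ d ≤ 1 / 2 := fun j => by
    have h1 : 50 * ((d : ℝ) + 1) * αU j * (L : ℝ) ^ d ≤ 50 * ((d : ℝ) + 1) * αT d L αP * (L : ℝ) ^ d :=
      mul_le_mul_of_nonneg_right (mul_le_mul_of_nonneg_left (hαUT j) (by positivity)) (by positivity)
    have h2 : 50 * ((d : ℝ) + 1) * αT d L αP * (L : ℝ) ^ d = (3200 * ((d : ℝ) + 1) ^ 2 * ((d : ℝ) + 4) * (L : ℝ) ^ (d + 2) * αP) / 2 := by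
      unfold αT; ring
    have h3 : (50 * (d + 1) * αU j * (L : ℝ) ^ d : ℝ) = 50 * ((d : ℝ) + 1) * αU j * (L : ℝ) ^ d := by ring
    rw [h3]
    linarith
  -- the summable regime: a geometric sum at ratio `L^{−2} ≤ 1∕9`
  have hAQ : ∑ j ∈ Finset.range (n + 1), αU j ≤ 16 * ((d : ℝ) + 1) * ((d : ℝ) + 4) * c2' d L := by
    have hr0 : (0 : ℝ) ≤ ((L : ℝ) ^ 2)⁻¹ := by positivity
    have hL9 : (9 : ℝ) ≤ (L : ℝ) ^ 2 := by nlinarith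
    have hr9 : ((L : ℝ) ^ 2)⁻¹ ≤ 1 / 9 := by rw [one_div]; exact inv_anti₀ (by norm_num) hL9
    have hr1 : ((L : ℝ) ^ 2)⁻¹ < 1 := lt_of_le_of_lt hr9 (by norm_num)
    have hgeom : ∑ j ∈ Finset.range (n + 1), (((L : ℝ) ^ 2)⁻¹) ^ j ≤ 2 := by
      have h := geom_sum_Ico_le_of_lt_one hr0 hr1 (m := 0) (n := n + 1)
      rw [← Finset.range_eq_Ico, pow_zero] at h
      refine h.trans ?_
      rw [div_le_iff₀ (by linarith)]
      linarith
    calc ∑ j ∈ Finset.range (n + 1), αU j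
        ≤ ∑ j ∈ Finset.range (n + 1), 32 * ((d : ℝ) + 1) * ((d : ℝ) + 4) * αP * (((L : ℝ) ^ 2)⁻¹) ^ j :=
          Finset.sum_le_sum fun j hj => hαg j (Finset.mem_range.1 hj)
      _ = 32 * ((d : ℝ) + 1) * ((d : ℝ) + 4) * αP * ∑ j ∈ Finset.range (n + 1), (((L : ℝ) ^ 2)⁻¹) ^ j := by rw [Finset.mul_sum]
      _ ≤ 32 * ((d : ℝ) + 1) * ((d : ℝ) + 4) * αP * 2 := mul_le_mul_of_nonneg_left hgeom (by positivity)
      _ ≤ 16 * ((d : ℝ) + 1) * ((d : ℝ) + 4) * c2' d L := by nlinarith [hαP4, show (0 : ℝ) ≤ ((d : ℝ) + 1) * ((d : ℝ) + 4) by positivity]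
  have hεg' : ∀ j < n + 1, εU j ≤ (α + 256 * (d + 1) * (d + 4) * αP) * (1 / (L : ℝ)) ^ j := fun j hj => by
    refine (hεg j hj).trans (mul_le_mul_of_nonneg_right ?_ (by positivity))
    exact div_le_self (by positivity) hL1r
  exact ⟨αU, εU, hαU0, hα1, hαL, hU1, hreg, hAQ, hεU, hLε, hLb, hεg', hUst, hUb, hRlev, hRS⟩

end Letters

/-! ## §3 [5] (3.133), first entry, for `H₁,k(U)` on print's class, `∃`-first, the model letters derived -/

section Tower

variable {d : ℕ} (hd : 1 ≤ d) (L : ℕ) [NeZero L] (hL : 1 ≤ L) (hL3 : 3 ≤ L)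
  {𝔸 : Type*} [CStarAlgebra 𝔸] [Nontrivial 𝔸]
  {W : Type} [NormedAddCommGroup W] [InnerProductSpace ℂ W] [FiniteDimensional ℂ W] (φ : W ≃ₗ[ℂ] 𝔸)
  {Mφ Mφ' : ℝ} (hMφ : 0 ≤ Mφ) (hMφ' : 0 ≤ Mφ') (hφ : ∀ w, ‖φ w‖ ≤ Mφ * ‖w‖) (hφ' : ∀ X, ‖φ.symm X‖ ≤ Mφ' * ‖X‖)
  {a : ℝ} (ha : 0 < a) {a' : ℝ} (ha' : 0 < a')
  (τ : 𝔸 →ₗ[ℂ] ℂ) {Cτ : ℝ} (hτ : ∀ X, ‖τ X‖ ≤ Cτ * ‖X‖) (hCτ : 0 ≤ Cτ) {Mτ : ℝ} (hτm : ∀ X Y : 𝔸, ‖τ (X * Y)‖ ≤ Mτ * ‖X‖ * ‖Y‖) (hMτ : 0 ≤ Mτ)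
  {ρw : ℝ} (hρw : 0 ≤ ρw)
  (hτ₁ : ∀ X : 𝔸, τ (star X) = conj (τ X)) (hτ₂ : ∀ X Y : 𝔸, τ (X * Y) = τ (Y * X)) (hφτ : ∀ X Y : 𝔸, ⟪φ.symm X, φ.symm Y⟫_ℂ = τ (star X * Y))
  (AQ : ℝ) (hAQ16 : 16 * ((d : ℝ) + 1) * ((d : ℝ) + 4) * c2' d L ≤ AQ)

include hd hL hL3 hMφ hMφ' hφ hφ' ha ha' hτ hCτ hτm hMτ hρw hτ₁ hτ₂ hφτ hAQ16 in
/-- **[5] (3.133), FIRST ENTRY, FOR `H₁,k(U) = G₁,kQ_k†(Q_kG₁,kQ_k†)⁻¹` ON NE9's TOWER IN THE (190) SUP CURRENCY — ON PRINT's SMALL-FIELD CLASS (3.35)–(3.36),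
`∃ (α⋆, B, δ, A′, r₁)` FIRST, THE MODEL LETTERS DERIVED** (`𝔸` a non-trivial C⋆-algebra — e.g. `M_N(ℂ)`, `G = U(N)`; `1 ≤ d`, `3 ≤ L`; the Hilbert-structure
letters `φ, τ`, the weight-ratio bound `ρ_w` and any summable-regime letter `A_Q ≥ 16(d+1)(d+4)c₂′(d,L)` fixed before the `∃`).  For every height `n` on
print's diagonal `ηL^{n+1} = 1`, weights `c₀(L^{n+1})^d = c₁` with `|η|^d∕c₀ ≤ ρ_w`, period `m` (`1 ≤ m_i`), every `unitaryUnits`-valued background `U` in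
the THREE-WINDOW class — bond variables `‖U(b) − 1‖ ≤ αη`, plaquette variables `‖U(∂p) − 1‖ ≤ αη²`, bond gradients `‖U(x,μ) − U(x − e_μ,μ)‖ ≤ αη²`, for
some `0 ≤ α ≤ α⋆` —, every geometry and all rates `σ > 0`, `0 ≤ ρ ≤ r₁∕d`, `ρ + σ ≤ δ∕d`: THERE ARE a regularity display `αU` of the level averages
`Ū^j` with `αU_j ≤ 1∕64`, the onto-threshold `50(d+1)αU_jL^d ≤ ½`, the `U1`-membership `hU1` and the block-loop display `hreg` ([4] Prop. 2: §1), and a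
positivity witness `hpos` of `Δ_{a,k}(U)` ([5] Thm 3.11: `B9Thm311LaplaceAkPositiveDiagonal`), such that
`HasMaj S^{coarse}_m S^{fine}_m (H₁,k(U)ᵉ↾ℝ) (B·(M†eK_d(1))·e^{δ}·A′·c₀(1,σ)^d·e^{−ρ·d})`, `M† = M_φ′e^{100d(d+1)L^dA_Q}M_φ·2d`, with
`H₁,k(U) = B9Eq326OperatorTower.H1k … αU hα1 hU1 hreg … hαL hpos` — «Y5c» `exists_hasMaj_H1k_tower` with its model letters (`hα0`, `hα1`, `hαL`, `hU1`, `hreg`,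
the level profile `ε`, `hLb`, `hUst`, `hUb`, `hRlev`, `hεg`, `hAQ`, `hpos′`, `hpos`) ALL DERIVED from the three windows (§2 + the two Thm 3.11 theorems of the
NE9 cell); only the windows, the weights, the period and the rates stay under the `∀`.  The operator does not depend on the display nor on the witness
(«Y12c» `Beta.RemainderTowerDisplayIrrel.H1k_display_irrel`: any other admissible display ∕ witness gives the same map). [cite: Balaban1985BackgroundPropagators, (3.126) p.420, (3.132)–(3.133) p.422, p.423,
Thm 3.3 (3.42) p.397+p.399, Thm 3.11 p.416, (3.35)–(3.37) p.396, (3.15) p.393] [cite: Balaban1985Variational, (129) p.297, (190) p.308]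
[cite: Balaban1985Averaging, Prop. 2 (52)–(54) p.26, (42)–(43) pp.23–24, (18) p.21] [cite: Balaban1984PropagatorsII, (2.51)–(2.52) p.232, (2.54) p.233, Lemma 2.1 (2.61) p.234] -/
theorem exists_hasMaj_H1k_tower_plaquette :
    ∃ αs B δ A' r₁ : ℝ, 0 < αs ∧ 0 ≤ B ∧ 0 < δ ∧ 0 ≤ A' ∧ 0 < r₁ ∧
      ∀ (n : ℕ) (η : ℝ) (_hηL : η * (L : ℝ) ^ (n + 1) = 1) (c₀ c₁ : ℝ) [Fact (0 < c₀)] [Fact (0 < c₁)]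
        (_hw : c₀ * ((L : ℝ) ^ (n + 1)) ^ d = c₁) (_hρ : |η| ^ d / c₀ ≤ ρw) (m : Fin d → ℕ) [∀ i, NeZero (m i)] (_hm : ∀ i, 1 ≤ m i)
        (U : Bond d (towerP L m (n + 1)) → 𝔸ˣ) (_hUu : ∀ b, U b ∈ unitaryUnits 𝔸)
        (α : ℝ) (_hα : 0 ≤ α) (_hαle : α ≤ αs) (_hUη : ∀ b, ‖(U b : 𝔸) - 1‖ ≤ α * η)
        (_hpl : ∀ p : B9SectCLatticeCarrier.Plaq d (towerP L m (n + 1)), ‖(plaqHolU U p : 𝔸) - 1‖ ≤ α * η ^ 2)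
        (_hUgrad : ∀ (x : TSite d (towerP L m (n + 1))) (μ : Fin d), ‖(U (x, μ) : 𝔸) - U (unshift μ x, μ)‖ ≤ α * η ^ 2)
        (η₀ L₀ M₀ R : ℝ) (H : Prop)
        (ρ σ : ℝ) (_hσ : 0 < σ) (_hρ0 : 0 ≤ ρ) (_hρI : ρ ≤ r₁ / d) (_hρ₁ : ρ + σ ≤ δ / d),
        ∃ (αU : ℕ → ℝ) (hα1 : ∀ j, αU j ≤ 1 / 64) (hαL : ∀ j, 50 * (d + 1) * αU j * (L : ℝ) ^ d ≤ 1 / 2)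
          (hU1 : ∀ (j : ℕ) (x : B7Prop1Explicit.Site d) (k : Fin d), perCfg (towerP L m (j + 1)) (UlevOf L m (n + 1) U j) x k ∈ U1 𝔸)
          (hreg : ∀ (j : ℕ) (y : TSite d (towerP L m j)) (k : Fin d) (ρ' : Fin d → Fin L),
            ‖((Wcx L (perCfg (towerP L m (j + 1)) (UlevOf L m (n + 1) U j)) (cornerSite L y) k (boxVec L ρ') : 𝔸ˣ) : 𝔸) - 1‖ ≤ αU j)
          (hpos : ∀ x : BondL2K ℂ d (towerP L m (n + 1)) c₀ W, x ≠ 0 →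
            0 < RCLike.re ⟪x, laplaceAk L m n φ η U hL αU hα1 hU1 hreg τ (c₀ := c₀) (c₁ := c₁) a x⟫_ℂ),
        HasMaj
          (supSize (toB6 (torusGeom m η₀ L₀ M₀) R H)
            (fun y => Finset.univ.filter fun c : Bond d m => bpos c = UT.toSite m y)
            (fun c => UT.ofSite m (bpos c)) : BlockNorm (toB6 (torusGeom m η₀ L₀ M₀) R H) (Bond d m → W))
          (supSize (toB6 (torusGeom m η₀ L₀ M₀) R H)
            (fun y => Finset.univ.filter fun b : Bond d (towerP L m (n + 1)) =>
              blockCoord (L ^ (n + 1)) m (siteCast (towerP_eq_fineP_pow L m (n + 1)) (bpos b)) = UT.toSite m y)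
            (fun b => UT.ofSite m (blockCoord (L ^ (n + 1)) m (siteCast (towerP_eq_fineP_pow L m (n + 1)) (bpos b)))) :
              BlockNorm (toB6 (torusGeom m η₀ L₀ M₀) R H) (Bond d (towerP L m (n + 1)) → W))
          (((WL2.linearEquiv ℂ ℂ (fun _ : Bond d (towerP L m (n + 1)) => c₀) :
                BondL2K ℂ d (towerP L m (n + 1)) c₀ W ≃ₗ[ℂ] (Bond d (towerP L m (n + 1)) → W)).toLinearMap ∘ₗ
              H1k L m n φ η U hL αU hα1 hU1 hreg τ (c₀ := c₀) (c₁ := c₁) hαL hpos ∘ₗ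
              (WL2.linearEquiv ℂ ℂ (fun _ : Bond d m => c₁) : BondL2K ℂ d m c₁ W ≃ₗ[ℂ] (Bond d m → W)).symm.toLinearMap).restrictScalars ℝ)
          (fun y v => B * ((Mφ' * Real.exp (100 * d * (d + 1) * (L : ℝ) ^ d * AQ) * Mφ * ((2 * d : ℕ) : ℝ)) * Real.exp 1 *
              latticeConst d 1) * Real.exp δ * A' * (B6.c0 1 σ ^ d) *
            Real.exp (-(ρ * (toB6 (torusGeom m η₀ L₀ M₀) R H).dist y v))) := by
  have hL2 : 2 ≤ L := le_trans (by norm_num) hL3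
  have hL1r : (1 : ℝ) ≤ L := by exact_mod_cast hL
  have hL0 : (0 : ℝ) < L := lt_of_lt_of_le one_pos hL1r
  have hr0 : (0 : ℝ) ≤ 1 / (L : ℝ) := by positivity
  have hr1 : 1 / (L : ℝ) < 1 := by
    rw [div_lt_one hL0]; exact_mod_cast (lt_of_lt_of_le (by norm_num) hL3 : 1 < L)
  have hstar : ∀ X : 𝔸, ‖star X‖ ≤ ‖X‖ := fun X => (norm_star X).le
  obtain ⟨αs, B, δ, A', r₁, hαs, hB, hδ, hA', hr₁, HY⟩ :=
    exists_hasMaj_H1k_tower hd L hL hL3 φ hMφ hMφ' hφ hφ' hstar ha ha' hr0 hr1 τ hτ hCτ hτm hMτ hρw hτ₁ hτ₂ hφτ AQ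
  -- [5] Thm 3.11 on the diagonal, `∃ α₀` first: the bond operator WITH curvature (the NE9 OWNER's) and the site operator
  obtain ⟨αB, hαB, HB⟩ := exists_laplaceAk_pos_diagonal_closed L hL φ hMφ hMφ' hφ hφ' ha hr0 hr1 τ hτ hCτ hρw
  obtain ⟨αS, γS, hαS, hγS, HS⟩ := exists_strong_site_coercive_tower_diagonal L φ (a' := a') hMφ hMφ' hφ hφ' ha' hr0 hr1
  -- the constants: the profile slack `K`, the common threshold `A`, the onto-threshold size `P_L`, [4] Prop. 2's window `α_P = 2α⋆′`
  obtain ⟨K, hK0, hKdef⟩ : ∃ K : ℝ, 0 ≤ K ∧ K = 256 * ((d : ℝ) + 1) * ((d : ℝ) + 4) := ⟨_, by positivity, rfl⟩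
  obtain ⟨A, hA0, hAdef⟩ : ∃ A : ℝ, 0 < A ∧ A = min (min αs αB) αS := ⟨_, lt_min (lt_min hαs hαB) hαS, rfl⟩
  have hC0 : 0 < C0 d := C0_pos d
  have hc2 : 0 < c2' d L := c2'_pos d L hL
  obtain ⟨PL, hPL0, hPLdef⟩ : ∃ PL : ℝ, 0 < PL ∧ PL = 3200 * ((d : ℝ) + 1) ^ 2 * ((d : ℝ) + 4) * (L : ℝ) ^ (d + 2) :=
    ⟨_, by positivity, rfl⟩
  obtain ⟨αt, hαt0, hαtdef⟩ : ∃ αt : ℝ, 0 < αt ∧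
      αt = min (min (1 / (6 * C0 d)) (c2' d L / 8)) (min (1 / (2 * PL)) (A / (4 * K + 1))) :=
    ⟨_, lt_min (lt_min (by positivity) (by positivity)) (lt_min (by positivity) (by positivity)), rfl⟩
  have hαt1 : αt ≤ 1 / (6 * C0 d) := by rw [hαtdef]; exact (min_le_left _ _).trans (min_le_left _ _)
  have hαt2 : αt ≤ c2' d L / 8 := by rw [hαtdef]; exact (min_le_left _ _).trans (min_le_right _ _)
  have hαt3 : αt ≤ 1 / (2 * PL) := by rw [hαtdef]; exact (min_le_right _ _).trans (min_le_left _ _)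
  have hαt4 : αt ≤ A / (4 * K + 1) := by rw [hαtdef]; exact (min_le_right _ _).trans (min_le_right _ _)
  have hαP : 0 < 2 * αt := by positivity
  have hαP3 : C0 d * (2 * αt) ≤ 1 / 3 := by
    have h1 : C0 d * αt ≤ C0 d * (1 / (6 * C0 d)) := mul_le_mul_of_nonneg_left hαt1 hC0.le
    have h2 : C0 d * (1 / (6 * C0 d)) = 1 / 6 := by field_simp
    linarith
  have hαP4 : 4 * (2 * αt) ≤ c2' d L := by linarith
  have hαPL : 3200 * ((d : ℝ) + 1) ^ 2 * ((d : ℝ) + 4) * (L : ℝ) ^ (d + 2) * (2 * αt) ≤ 1 := by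
    rw [← hPLdef]
    have h1 : PL * (2 * αt) ≤ PL * (2 * (1 / (2 * PL))) := mul_le_mul_of_nonneg_left (by linarith) hPL0.le
    have h2 : PL * (2 * (1 / (2 * PL))) = 1 := by field_simp
    linarith
  have hKαt : (4 * K + 1) * αt ≤ A := by
    have h := mul_le_mul_of_nonneg_left hαt4 (by positivity : (0 : ℝ) ≤ 4 * K + 1)
    rwa [mul_div_cancel₀ _ (by positivity : (4 * K + 1 : ℝ) ≠ 0)] at h
  refine ⟨min (A / 2) αt, B, δ, A', r₁, lt_min (by positivity) hαt0, hB, hδ, hA', hr₁, ?_⟩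
  intro n η hηL c₀ c₁ _ _ hw hρ m _ hm U hUu α hα hαle hUη hpl hUgrad η₀ L₀ M₀ R H ρ σ hσ hρ0 hρI hρ₁
  have hαA : α ≤ A / 2 := hαle.trans (min_le_left _ _)
  have hααt : α ≤ αt := hαle.trans (min_le_right _ _)
  have hαlt : α < 2 * αt := by linarith only [hααt, hαt0]
  have hηpos : 0 < η := by
    have : η = ((L : ℝ) ^ (n + 1))⁻¹ := (inv_eq_of_mul_eq_one_left hηL).symm
    rw [this]; positivity
  obtain ⟨αU, εU, hαU0, hα1, hαL, hU1, hreg, hAQs, hεU, hLε, hLb, hεg, hUst, hUb, hRlev, hRS⟩ :=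
    letters_of_windows L m n φ τ hτ₂ hφτ hL3 hUu hαP hαP3 hαP4 hαPL hηL hα hαlt hUη hpl
  -- the common smallness `α″ = α + 2Kα⋆′ ≤ A`
  have hα''A : α + 2 * K * αt ≤ A := by linarith only [hαA, hKαt, hαt0.le, mul_nonneg hK0 hαt0.le]
  have hα''0 : 0 ≤ α + 2 * K * αt := by positivity
  have hα''s : α + 2 * K * αt ≤ αs := hα''A.trans (by rw [hAdef]; exact (min_le_left _ _).trans (min_le_left _ _))
  have hα''B : α + 2 * K * αt ≤ αB := hα''A.trans (by rw [hAdef]; exact (min_le_left _ _).trans (min_le_right _ _))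
  have hα''S : α + 2 * K * αt ≤ αS := hα''A.trans (by rw [hAdef]; exact min_le_right _ _)
  have hαle'' : α ≤ α + 2 * K * αt := le_add_of_nonneg_right (by positivity)
  have hUη'' : ∀ b, ‖(U b : 𝔸) - 1‖ ≤ (α + 2 * K * αt) * η := fun b =>
    (hUη b).trans (mul_le_mul_of_nonneg_right hαle'' hηpos.le)
  have hpl'' : ∀ p : B9SectCLatticeCarrier.Plaq d (towerP L m (n + 1)), ‖(plaqHolU U p : 𝔸) - 1‖ ≤ (α + 2 * K * αt) * η ^ 2 := fun p =>
    (hpl p).trans (mul_le_mul_of_nonneg_right hαle'' (sq_nonneg η))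
  have hUgrad'' : ∀ (x : TSite d (towerP L m (n + 1))) (μ : Fin d), ‖(U (x, μ) : 𝔸) - U (unshift μ x, μ)‖ ≤ (α + 2 * K * αt) * η ^ 2 :=
    fun x μ => (hUgrad x μ).trans (mul_le_mul_of_nonneg_right hαle'' (sq_nonneg η))
  have hK2 : α + 256 * ((d : ℝ) + 1) * ((d : ℝ) + 4) * (2 * αt) = α + 2 * K * αt := by rw [hKdef]; ring
  have hεg'' : ∀ j < n + 1, εU j ≤ (α + 2 * K * αt) * (1 / (L : ℝ)) ^ j := fun j hj => by
    have h := hεg j hj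
    rwa [hK2] at h
  have hAQ' : ∑ j ∈ Finset.range (n + 1), αU j ≤ AQ := hAQs.trans hAQ16
  -- the two positivity witnesses at `α″`
  have hpos : ∀ x : BondL2K ℂ d (towerP L m (n + 1)) c₀ W, x ≠ 0 →
      0 < RCLike.re ⟪x, laplaceAk L m n φ η U hL αU hα1 hU1 hreg τ (c₀ := c₀) (c₁ := c₁) a x⟫_ℂ := fun x hx =>
    HB n η hηL c₀ c₁ hw hρ m U αU hα1 hU1 hreg εU hεU hLε hα''0 hα''B hRS hUb hUη'' hpl'' hεg'' x hx
  have hpos' : ∀ x : SiteL2K ℂ d (towerP L m (n + 1)) c₀ W, x ≠ 0 → 0 < RCLike.re ⟪x, laplacePrimeAk L m n φ η U a' (c₁ := c₁) x⟫_ℂ := by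
    intro x hx
    have key := HS n η hηL c₀ c₁ hw m U hRS (α + 2 * K * αt) hα''0 hα''S hUb hUη'' εU hεU hεg'' hLε hLb x
    have hx2 : 0 < ‖x‖ ^ 2 := by positivity
    have hp : 0 < γS * (‖covDerivL2K ℂ c₀ ((η : ℂ))⁻¹ (adTransportW φ (fun _ : Bond d (towerP L m (n + 1)) => (1 : 𝔸ˣ))) x‖ ^ 2 + ‖x‖ ^ 2) :=
      mul_pos hγS (add_pos_of_nonneg_of_pos (sq_nonneg _) hx2)
    exact hp.trans_le key
  refine ⟨αU, hα1, hαL, hU1, hreg, hpos, ?_⟩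
  exact HY n η hηL c₀ c₁ hw hρ m hm U αU hαU0 hα1 hαL hU1 hreg εU hεU hLε hLb (α + 2 * K * αt) hα''0 hα''s hUst hUb hUη'' hpl'' hUgrad''
    hRlev hεg'' hAQ' hpos' hpos η₀ L₀ M₀ R H ρ σ hσ hρ0 hρI hρ₁

end Tower

end Literature.MathematicalPhysics.QuantumFieldTheory.Balaban1983to89.Beta.RemainderHasMajH1kTowerPlaquette

end
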